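import Summits.QuantumFields.BalabanUV.T4Continuum.Spine.NE1p.DressedSmallFieldComponentSetsWitness

/-!
# T⁴ programme, spine estimate NE1′ (node O3b/H2) — WITNESS «THE SET-LABELLED END FIRES — AND NEEDS ROOM», PART 2 (LOCATED + GENUINE):
# FOUR admissible set-labelled outer labels at the unit cube, the majorant mass `εS + εS²∕4 + vC` in closed form — the two-pair set is
# print's «sum over two components» and contributes the QUADRATIC term —, and the END's bounded quantity is NOT zero

Cell `pub-balaban`, sub-cell `t4`, row NE1′ formalisation crew (`t4/formal/NE1p/LEAVES.md` row W63 ∕ DAG N29zzzn; open follow-up (iii) of the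
CLOSED leaf-01 lineage, l.21310; BOOKED typer R-T136 l.21867; X189 its read), unit `b2b-balaban-t4-ne1p-formalise-leaf-06` (gen 12); PART 2 of
2 (D1) — imports PART 1
`Spine/NE1p/DressedSmallFieldComponentSetsWitness` ONLY and re-enters its namespace; THEOREMS ONLY (0 def, 0 `def … : Prop`, 0 cite, 0 sorry,
0 `attribute`); nothing of PART 1 ∕ S41 ∕ N0w ∕ W53 ∕ W50 ∕ W45 ∕ W41 ∕ W35 ∕ W33 ∕ W24 is restated — `termsS`, `JS`, `JS_card`, `majS`,
`majS_nonneg`, `cS`, `GS_apply`, `actS`, `εS`, `εS_pos`, `εS_mul_K₀_le_half`, `componentSetsEnd_fires_closed`, W53's `JC`∕`JC_eq`∕`mC`∕`vC`∕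
`vC_pos`∕`vC_le`, W50.1's `coveringFamilies_emptyFootprint`∕`powerset_unitCube`, W45's `coveringFamilies_unitCube`, W41's `dj_X₀`∕
`termAt_coreW_pencil`∕`closedForm_real_sub_zero`∕`norm_term_le`, W33's `integral_incr_pos`, W24's `X₀_val`∕`dressedConst_le_one`∕
`exp_locE_cube` are used BY NAME.

* §6 LOCATED, IN KERNEL: **`termsS_X₀_card = 4`** — at `X₀` the admissible labels are the THREE covered labels (`W′ = ∅`, the ONE
  covering family `{X₀}` of W45's `coveringFamilies_unitCube`, one NONEMPTY label set out of `JS X₀`, `#JS = 3`) and the ONE uncovered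
  label (`W′ = {0}`, the empty family of W50.1's `coveringFamilies_emptyFootprint`, the empty choice): `Finset.card_sigma` ∕
  `Finset.card_pi`, no `decide`; **`majS_sum_X₀ = εS + εS²∕4 + vC`** — the covered fibre carries `Π_{j∈JC X₀}(1 + εS∕2) − 1 = εS + εS²∕4`
  (`Finset.prod_one_add`: the singletons give the LINEAR term, the two-pair set — TWO components determining the same member, print's
  n = 2 — the QUADRATIC one), the uncovered fibre the letter `vC`; `majS_sum_X₀_le_one`;
* §7 GENUINE: `actS_X₀` (every label's core has the SAME W41 integral), `actS_live`, **`componentSetsEnd_live`** — the END's bounded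
  quantity is NOT zero (W24's `exp_locE_cube` BY NAME); the closing `example` conjoins bound and liveness on the same datum.

HONEST FRAMING.  A DECIDED TOY ([folklore]); as PART 1: nothing asserted about Bałaban's densities; the quadratic term is OUR toy's
two-label set at W53's reading `cl = id`, not Bałaban's two-component configuration; 0 binders instantiated on Bałaban's densities; no wall
item; wall v1.8 (T4-DAG v48) does NOT move; R-t4r2-Q2 NOT met; NE1′ ⇐ the named binders — NOT proved, NOT printed; spine PROVED 0∕9;
count 9 unchanged.  Rung (B)+1 on ONE finite four-torus — NOT infinite volume, NOT a mass gap, NOT OS on ℝ⁴, NOT Clay.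
HONEST DEPENDENCY: continuum YM on T⁴ ⇐ BetaPertH ∧ nine spine estimates (0/9 proved); BetaPertH ⇐ (D1) ∧ (D4) ∧ CAP+tail; G-an2-4
gates asym, D1 and NE2/3/4.
-/

noncomputable section

namespace Summit.QuantumFields.BalabanUV.T4Continuum.NE1p.DressedSmallFieldComponentSetsWitness

open Set Metric MeasureTheory Complex
open scoped BigOperators
open Literature.MathematicalPhysics.QuantumFieldTheory.Balaban1983to89
open Literature.MathematicalPhysics.QuantumFieldTheory.Balaban1983to89.B12TreeDecay (K₀ K₀_pos)
open Literature.MathematicalPhysics.QuantumFieldTheory.Balaban1983to89.B13Resummation (locE)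
open Literature.MathematicalPhysics.QuantumFieldTheory.Balaban1983to89.B13FamilySum (coveringFamilies mem_coveringFamilies)
open Literature.MathematicalPhysics.QuantumFieldTheory.Balaban1983to89.TreeLengthTorus (TPt TDom tsys torusTreeLen)
open Literature.MathematicalPhysics.QuantumFieldTheory.Balaban1983to89.TreeLengthTorusGeometry (tgeometry TTouch)
open Summit.QuantumFields.BalabanUV.T4Continuum.B13HistMeasurable (B13HistM)
open Summit.QuantumFields.BalabanUV.T4Continuum.B13HistWitness (toyFrame)
open Summit.QuantumFields.BalabanUV.T4Continuum.NE1p.DressedSmallFieldTorusWitness (X₀ X₀_val dressedConst_le_one exp_locE_cube)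
open Summit.QuantumFields.BalabanUV.T4Continuum.NE1p.DressedSmallFieldCoresWitness (E1 crd liveTable Acst Acst_pos incr integral_incr_pos)
open Summit.QuantumFields.BalabanUV.T4Continuum.NE1p.DressedSmallFieldCoresMassWitness (cM cM_pos)
open Summit.QuantumFields.BalabanUV.T4Continuum.NE1p.DressedSmallFieldDepCoresWitness (dj_X₀ termAt_coreW_pencil closedForm_real_sub_zero
  norm_term_le)
open Summit.QuantumFields.BalabanUV.T4Continuum.NE1p.DressedSmallFieldFamiliesWitness (α₆F α₆F_le_one coveringFamilies_unitCube)
open Summit.QuantumFields.BalabanUV.T4Continuum.NE1p.DressedSmallFieldInnerLabelsWitness (RI RI_pos coveringFamilies_emptyFootprint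
  powerset_unitCube)
open Summit.QuantumFields.BalabanUV.T4Continuum.NE1p.DressedSmallFieldComponentsWitness (vC vC_pos vC_le εC εC_pos mC JC JC_eq JC_card)

section Torus
variable (N : ℕ) [NeZero N]

/-! ## §6 LOCATED, IN KERNEL: FOUR admissible labels at the unit cube; the mass in closed form with its quadratic term -/

open Classical in
/-- **THE SET-LABELLED INDEX OF THE UNIT CUBE HAS EXACTLY FOUR MEMBERS** [decided, kernel]: `W′ = ∅` — the ONE covering family `{X₀}`
(W45) with its `#JS X₀ = 3` nonempty label sets; `W′ = {0}` — the ONE (empty) family (W50.1) with its one (empty) choice: `3 + 1`. [folklore] -/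
theorem termsS_X₀_card : (termsS N (X₀ N)).card = 4 := by
  have hempty : coveringFamilies (Finset.univ : Finset (TDom 4 N)) (tgeometry 4 N).cubes ∅ = {∅} :=
    coveringFamilies_emptyFootprint (tgeometry 4 N)
  unfold termsS
  rw [show (tgeometry 4 N).cubes (X₀ N) = {0} from X₀_val N, Finset.card_sigma, powerset_unitCube N, Finset.sum_insert (by simp),
    Finset.sum_singleton]
  rw [Finset.sdiff_empty, Finset.sdiff_self, coveringFamilies_unitCube, hempty, Finset.card_sigma, Finset.card_sigma,
    Finset.sum_singleton, Finset.sum_singleton, Finset.card_pi, Finset.card_pi, Finset.prod_singleton, Finset.prod_empty, JS_card]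
  norm_num

/-- Each pair of W53's `JC X₀` weighs `εS∕2` at the unit cube (`mC X₀ b = ½·e^{−R₀·0}`). [arith] -/
theorem pairWeight_X₀ (j : Σ _ : TDom 4 N, Bool) (hj : j ∈ JC N (X₀ N)) : εS N * mC N j.1 j.2 = εS N / 2 := by
  rw [JC_eq, Finset.mem_sigma, Finset.mem_singleton] at hj
  obtain ⟨Z', b⟩ := j
  simp only at hj
  rw [hj.1]; unfold mC; rw [dj_X₀, mul_zero, neg_zero, Real.exp_zero, mul_one]; ring

open Classical in
/-- **THE COVERED FIBRE's MASS IS `Π(1 + w) − 1 = (1 + εS∕2)² − 1 = εS + εS²∕4`**: over the three nonempty label sets the weights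
`Π_{j∈T} εS·mC j` sum to `Π_{j ∈ JC X₀}(1 + εS∕2) − 1` (`Finset.prod_one_add`, the empty set removed) — linear term from the two
singletons, QUADRATIC term from the two-pair set. [folklore] -/
theorem setSum_X₀ : ∑ T ∈ JS N (X₀ N), ∏ j ∈ T, εS N * mC N j.1 j.2 = εS N + εS N ^ 2 / 4 := by
  have hE : JS N (X₀ N) = (JC N (X₀ N)).powerset.erase ∅ := by
    unfold JS; ext T
    simp only [Finset.mem_filter, Finset.mem_erase, Finset.mem_powerset, Finset.nonempty_iff_ne_empty, ne_eq]
    tauto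
  rw [hE, Finset.sum_erase_eq_sub (Finset.empty_mem_powerset _), Finset.prod_empty, ← Finset.prod_one_add,
    Finset.prod_congr rfl fun j hj => by rw [pairWeight_X₀ N j hj], Finset.prod_const, JC_card]
  ring

open Classical in
/-- **THE MAJORANT MASS OF THE UNIT CUBE IN CLOSED FORM**: `Σ_{l ∈ termsS X₀} majS l = εS + εS²∕4 + vC`. [folklore] -/
theorem majS_sum_X₀ : ∑ l ∈ termsS N (X₀ N), majS N l = εS N + εS N ^ 2 / 4 + vC N := by
  have hempty : coveringFamilies (Finset.univ : Finset (TDom 4 N)) (tgeometry 4 N).cubes ∅ = {∅} :=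
    coveringFamilies_emptyFootprint (tgeometry 4 N)
  -- the covered fibre: `W′ = ∅`, the ONE family `{X₀}`, THREE nonempty label sets
  have hA : ∑ s ∈ (coveringFamilies (Finset.univ : Finset (TDom 4 N)) (tgeometry 4 N).cubes ({0} \ ∅)).sigma
      (fun F => F.pi (JS N)), majS N ⟨∅, s⟩ = εS N + εS N ^ 2 / 4 := by
    rw [Finset.sdiff_empty, coveringFamilies_unitCube, Finset.sum_sigma, Finset.sum_singleton]
    unfold majS
    simp only [Finset.card_empty, pow_zero, one_mul]
    rw [← Finset.prod_sum {X₀ N} (JS N) (fun _ T => ∏ j ∈ T, εS N * mC N j.1 j.2), Finset.prod_singleton, setSum_X₀]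
  -- the uncovered fibre: `W′ = {0}`, the EMPTY family, the empty choice — the letter `v`
  have hB : ∑ s ∈ (coveringFamilies (Finset.univ : Finset (TDom 4 N)) (tgeometry 4 N).cubes ({0} \ {0})).sigma
      (fun F => F.pi (JS N)), majS N ⟨{0}, s⟩ = vC N := by
    rw [Finset.sdiff_self, hempty, Finset.sum_sigma, Finset.sum_singleton, Finset.pi_empty, Finset.sum_singleton]
    unfold majS
    rw [Finset.card_singleton, pow_one, Finset.attach_empty, Finset.prod_empty, mul_one]
  unfold termsS
  rw [show (tgeometry 4 N).cubes (X₀ N) = {0} from X₀_val N, Finset.sum_sigma, powerset_unitCube N, Finset.sum_insert (by simp),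
    Finset.sum_singleton, hA, hB]

/-- The mass is positive and `≤ 1` (`εS·K₀ ≤ ½` gives `εS ≤ ½` as `K₀(64,8) ≥ 1` is NOT needed: `εS = εC∕2 ≤ α₆F∕2 ≤ ½` directly; `vC ≤ 1∕64`). [arith] -/
theorem majS_sum_X₀_pos_le_one : 0 < εS N + εS N ^ 2 / 4 + vC N ∧ εS N + εS N ^ 2 / 4 + vC N ≤ 1 := by
  have hε := εS_pos N
  have hv := vC_pos N
  have hvle := vC_le N
  have hεle : εS N ≤ 1 / 2 := by
    unfold εS εC
    have hK := K₀_pos (64 : ℝ) 8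
    have hE : 1 ≤ Real.exp (5 * RI N) := Real.one_le_exp (by linarith [RI_pos N])
    have hKE : 1 ≤ K₀ 64 8 * Real.exp (5 * RI N) := by
      have hK1 : 1 ≤ K₀ 64 8 := by
        unfold K₀ B12TreeDecay.kappa₀ B12TreeDecay.a₀
        rw [le_div_iff₀ (by positivity), one_mul, show (64 : ℝ) * Real.log (2 * ((8 : ℕ) + 1 : ℝ) ^ 2) =
          Real.log ((2 * ((8 : ℕ) + 1 : ℝ) ^ 2) ^ (64 : ℕ)) by rw [Real.log_pow]; norm_num, Real.exp_log (by positivity)]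
        norm_num
      nlinarith
    have h1 : α₆F / (K₀ 64 8 * Real.exp (5 * RI N)) ≤ 1 := by
      rw [div_le_one (by positivity)]; exact α₆F_le_one.trans hKE
    linarith
  constructor
  · positivity
  · nlinarith

open Classical in
/-- … hence `Σ majS ≤ 1` at `X₀`. [arith] -/
theorem majS_sum_X₀_le_one : ∑ l ∈ termsS N (X₀ N), majS N l ≤ 1 := by
  rw [majS_sum_X₀]; exact (majS_sum_X₀_pos_le_one N).2

/-! ## §7 GENUINE: on `X₀` the activity is FOUR live terms with ONE common integral, and the END's bounded quantity is NOT zero -/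

variable (r : ℝ) (hr : 0 ≤ r)

open Classical in
/-- **THE ACTIVITY AT `X₀` IN CLOSED FORM**: `act k s X₀ = (cM r∕2)·(εS + εS²∕4 + vC)·∫ e^{s·r·e^{−(v 0)²}}·e^{−‖v‖²} dv` (W41's
`termAt_coreW_pencil` BY NAME; the weights add up by `majS_sum_X₀`). [folklore] -/
theorem actS_X₀ (k : ℕ) (s : ℂ) :
    actS N r hr k s (X₀ N) = ((cM r / 2 * (εS N + εS N ^ 2 / 4 + vC N) : ℝ) : ℂ) *
      ∫ v : E1, cexp (s * ((r : ℂ) * (Real.exp (-(crd v ^ 2)) : ℂ))) * cexp (-(((‖v‖ ^ 2 : ℝ) : ℂ))) := by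
  unfold actS
  simp only [GS_apply, termAt_coreW_pencil]
  rw [← Finset.sum_mul, ← majS_sum_X₀ N, Finset.mul_sum]
  push_cast
  unfold cS
  push_cast
  rfl

/-- The increment between a REAL source `t` and `0` at `X₀` (W41's `closedForm_real_sub_zero`). [folklore] -/
theorem actS_real_sub_zero (k : ℕ) (t : ℝ) :
    actS N r hr k (t : ℂ) (X₀ N) - actS N r hr k 0 (X₀ N) =
      ((cM r / 2 * (εS N + εS N ^ 2 / 4 + vC N) : ℝ) : ℂ) * ((∫ v, incr (t * r) v : ℝ) : ℂ) := by
  rw [actS_X₀, actS_X₀]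
  exact closedForm_real_sub_zero _ r hr t

/-- **THE ATTACHED PART OF THE ACTIVITY IS NOT ZERO** (positive total weight, W33's `∫ incr r > 0` for `0 < r`). [folklore] -/
theorem actS_live (hr0 : 0 < r) (k : ℕ) : actS N r hr k 1 (X₀ N) ≠ actS N r hr k 0 (X₀ N) := by
  intro h
  have h0 := sub_eq_zero.2 h
  rw [show (1 : ℂ) = ((1 : ℝ) : ℂ) from Complex.ofReal_one.symm, actS_real_sub_zero, one_mul] at h0
  have hc : 0 < cM r / 2 * (εS N + εS N ^ 2 / 4 + vC N) := mul_pos (half_pos (cM_pos r)) (majS_sum_X₀_pos_le_one N).1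
  rcases mul_eq_zero.1 h0 with hc0 | hI
  · exact hc.ne' (by exact_mod_cast hc0)
  · exact (integral_incr_pos r hr0).ne' (by exact_mod_cast hI)

/-- The activities at `X₀` lie STRICTLY inside the unit disc for `‖s‖ ≤ 2` (mass `≤ 1`, W41's `norm_term_le`, `A ≤ 1`, `√π < √(2π)`). [folklore] -/
theorem norm_actS_X₀_lt_one (k : ℕ) {s : ℂ} (hs : ‖s‖ ≤ 2) : ‖actS N r hr k s (X₀ N)‖ < 1 := by
  rw [actS_X₀]
  have hp0 : 0 ≤ εS N + εS N ^ 2 / 4 + vC N := (majS_sum_X₀_pos_le_one N).1.le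
  have hp1 := (majS_sum_X₀_pos_le_one N).2
  have hπ : 0 < Real.sqrt Real.pi := Real.sqrt_pos.2 Real.pi_pos
  have hlt : Real.sqrt Real.pi < Real.sqrt (2 * Real.pi) := Real.sqrt_lt_sqrt Real.pi_pos.le (by linarith [Real.pi_pos])
  have hq : Real.sqrt Real.pi / Real.sqrt (2 * Real.pi) < 1 := (div_lt_one (hπ.trans hlt)).2 hlt
  have hA : Acst ≤ 1 := dressedConst_le_one
  have hb := norm_term_le r hr hs
  have hn : ‖((cM r / 2 * (εS N + εS N ^ 2 / 4 + vC N) : ℝ) : ℂ) *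
        ∫ v : E1, cexp (s * ((r : ℂ) * (Real.exp (-(crd v ^ 2)) : ℂ))) * cexp (-(((‖v‖ ^ 2 : ℝ) : ℂ)))‖ =
      (εS N + εS N ^ 2 / 4 + vC N) * ‖((cM r / 2 : ℝ) : ℂ) * ∫ v : E1, cexp (s * ((r : ℂ) * (Real.exp (-(crd v ^ 2)) : ℂ))) *
        cexp (-(((‖v‖ ^ 2 : ℝ) : ℂ)))‖ := by
    rw [norm_mul, norm_mul, Complex.norm_real, Complex.norm_real, Real.norm_eq_abs, Real.norm_eq_abs, abs_mul, abs_of_nonneg hp0]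
    ring
  rw [hn]
  calc (εS N + εS N ^ 2 / 4 + vC N) * ‖((cM r / 2 : ℝ) : ℂ) * ∫ v : E1, cexp (s * ((r : ℂ) * (Real.exp (-(crd v ^ 2)) : ℂ))) *
          cexp (-(((‖v‖ ^ 2 : ℝ) : ℂ)))‖
      ≤ 1 * (Acst / 2 * (Real.sqrt Real.pi / Real.sqrt (2 * Real.pi))) := mul_le_mul hp1 hb (norm_nonneg _) zero_le_one
    _ < 1 := by
        rw [one_mul]
        have := Acst_pos
        nlinarith

open Classical in
/-- **THE END's BOUNDED QUANTITY IS NOT ZERO** [decided toy]: equal dressed outputs on the cube would give equal activities at `X₀` (W24's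
`exp_locE_cube` BY NAME), contradicting `actS_live`. [folklore] -/
theorem componentSetsEnd_live (hr0 : 0 < r) (k : ℕ) :
    locE (tgeometry 4 N).ι (tgeometry 4 N).cubes (actS N r hr k 1) ((tgeometry 4 N).cubes (X₀ N)) ≠
      locE (tgeometry 4 N).ι (tgeometry 4 N).cubes (actS N r hr k 0) ((tgeometry 4 N).cubes (X₀ N)) := by
  intro h
  have h1 := exp_locE_cube N (w := actS N r hr k 1) (norm_actS_X₀_lt_one N r hr k (by simp))
  have h0 := exp_locE_cube N (w := actS N r hr k 0) (norm_actS_X₀_lt_one N r hr k (by simp))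
  have h' : cexp (locE (TTouch (d := 4) (N := N)) (fun Z : (tsys 4 N).Dom => Z.1) (actS N r hr k 1) {0}) =
      cexp (locE (TTouch (d := 4) (N := N)) (fun Z : (tsys 4 N).Dom => Z.1) (actS N r hr k 0) {0}) := congrArg cexp h
  rw [h1, h0, add_right_inj] at h'
  exact actS_live N r hr hr0 k h'

open Classical in
/-- **THE END FIRES ON A LIVE DATUM**: S41.1's bound holds AND the bounded quantity is not zero. [folklore] -/
example (hr0 : 0 < r) (k : ℕ) :
    locE (tgeometry 4 N).ι (tgeometry 4 N).cubes (actS N r hr k 1) ((tgeometry 4 N).cubes (X₀ N)) ≠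
        locE (tgeometry 4 N).ι (tgeometry 4 N).cubes (actS N r hr k 0) ((tgeometry 4 N).cubes (X₀ N)) ∧
      ‖locE (tgeometry 4 N).ι (tgeometry 4 N).cubes (actS N r hr k 1) ((tgeometry 4 N).cubes (X₀ N)) -
          locE (tgeometry 4 N).ι (tgeometry 4 N).cubes (actS N r hr k 0) ((tgeometry 4 N).cubes (X₀ N))‖ ≤ K₀ 64 8 :=
  ⟨componentSetsEnd_live N r hr hr0 k, componentSetsEnd_fires_closed N r hr k⟩

end Torus

end Summit.QuantumFields.BalabanUV.T4Continuum.NE1p.DressedSmallFieldComponentSetsWitness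

end
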